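import Summits.CriticalPhenomena.SAWScalingLimit.Theorems.SAWLoopFugacityFlowAvoidanceLimitDeterminantalMatrix
import Summits.CriticalPhenomena.SAWScalingLimit.Theorems.SAWLoopFugacityFlowAvoidanceLimitDeterminantalStrands

/-!
# The strictly dilute loop gas at loop fugacity `n = -2`: one-vertex recursions — helper file 5/5
of stub `stub_determinantal` of line `symplectic-fermion-anchor` (crux `SAWLoopFugacityFlow.AvoidanceLimit`,
stmt-CriticalPhenomena-10649)

For `H ≤ ℤ²` and `Z(S; A) = Z_{⟨-2,0,x⟩}(H, S; A) = Σ_{F collision-free} x^{|F|} (-2)^{loops}`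
(`pfun_eq`): the source-free VERTEX RECURSION
`Z(S;∅) = Z(S∖v;∅) - x Σ_{u∼v} Z(S;{v}∆{u}) + x² Σ_{u∼v} Z(S∖{v,u};∅)` (`pfun_empty_eq`: a
configuration through `v` is counted twice by its two edges at `v`; opening the polygon at such an
edge gives an open strand `v → u`, one closed strand less, i.e. a factor `-2x`; the one-edge open
strands are subtracted back) and the two-source FIRST-STEP RECURSION
`Z(S;{a}∆{b}) = x Σ_{u∼a, u≠b} Z(S∖a;{u}∆{b}) + x[a∼b] Z(S∖{a,b};∅)` (`pfun_two_eq`). These are the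
free-fermion (`n = -2`) recursions matched by `det`/`adj` of `1 - xA` in file `…Determinantal`.
Folklore (the O(`-2`) loop gas is the free symplectic fermion: B. Nienhuis, Phys. Rev. Lett. 49
(1982) [Nienhuis1982]; G. Lawler, Probab. Surveys 15 (2018) Prop. 3.1 [Lawler2018]); no definitions.
-/

noncomputable section

open scoped BigOperators Topology symmDiff
open Filter Finset
open Literature.Probability.RandomPlanarGeometry Literature.Probability.LatticeModels

namespace Summit.CriticalPhenomena.SAWScalingLimit.Theorems.AvoidanceLimit.Anchor

namespace DetExpansion

-- Local notations only (NO definitions): indicator `[u ∼ v]`, degree, collision-free configurations, weight, `Z_{⟨-2,0,x⟩}`.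
local notation "aind[" H ", " u ", " v "]" =>
  (@ite ℝ (SimpleGraph.Adj H u v) (Classical.propDecidable _) (1 : ℝ) 0)
local notation "deg[" F ", " z "]" => Finset.card (Finset.filter (fun e => z ∈ e) F)
local notation "cfC[" H ", " S ", " A "]" =>
  Finset.filter (fun F => DiluteLoopModel.oscVerts S F = ∅) (DiluteLoopModel.configs H S A)
local notation "lw[" x ", " S ", " F "]" => (x ^ Finset.card F * (-2 : ℝ) ^ DiluteLoopModel.loops S F ∅)
local notation "pf[" H ", " x ", " S ", " A "]" =>
  DiluteLoopModel.partitionFunction (⟨-2, 0, x⟩ : DiluteLoopModel ℝ) H S A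

/-! ## The strictly dilute loop gas at `n = -2`: one-vertex recursions -/

section LoopGas

open DiluteLoopModel SimpleGraph

variable {H : SimpleGraph (Site 2)} [H.LocallyFinite]

/-- **At collision weight `0` only collision-free configurations survive**:
`Z_{⟨-2,0,x⟩}(S; A) = Σ_{F ∈ cfConfigs} x^{|F|} (-2)^{loops}`. [folklore] -/
theorem pfun_eq (x : ℝ) (S A : Finset (Site 2)) : pf[H, x, S, A] = ∑ F ∈ cfC[H, S, A], lw[x, S, F] := by
  rw [partitionFunction, sum_filter]
  refine sum_congr rfl fun F _ => ?_
  by_cases hosc : oscVerts S F = ∅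
  · rw [if_pos hosc]
    simp only [weight, hosc, Finset.powerset_empty, sum_singleton, card_empty, pow_zero, mul_one]
  · rw [if_neg hosc]
    refine sum_eq_zero fun T _ => ?_
    have : #(oscVerts S F) ≠ 0 := by rwa [ne_eq, card_eq_zero]
    simp [weight, zero_pow this]

/-- **Fibre count**: summing, over the other endpoint `u`, the configurations containing the edge
`{z, u}` counts each configuration `deg_F(z)` times. [folklore] -/
theorem sum_sum_filter_mk_mem {S : Finset (Site 2)} {C : Finset (Finset (Sym2 (Site 2)))}
    (hC : ∀ F ∈ C, F ⊆ edgesIn H S) (z : Site 2) (g : Finset (Sym2 (Site 2)) → ℝ) :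
    ∑ u ∈ S, ∑ F ∈ C.filter (fun F => s(z, u) ∈ F), g F = ∑ F ∈ C, (deg[F, z] : ℝ) * g F := by
  simp_rw [sum_filter]
  rw [sum_comm]
  refine sum_congr rfl fun F hF => ?_
  rw [← sum_filter, sum_const, nsmul_eq_mul, card_filter_mk_mem_eq_deg (hC F hF)]

/-- No configuration contains a non-edge. [folklore] -/
theorem sum_filter_mk_mem_eq_zero {S : Finset (Site 2)} {C : Finset (Finset (Sym2 (Site 2)))}
    (hC : ∀ F ∈ C, F ⊆ edgesIn H S) {z u : Site 2} (h : ¬H.Adj z u) (g : Finset (Sym2 (Site 2)) → ℝ) :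
    ∑ F ∈ C.filter (fun F => s(z, u) ∈ F), g F = 0 := by
  refine sum_eq_zero fun F hF => ?_
  obtain ⟨hF, he⟩ := mem_filter.1 hF
  exact absurd (by simpa using (mem_edgesIn_iff.1 (hC F hF he)).1) h

/-- Source-free configurations avoiding `v` are the source-free configurations of `S ∖ v`. [folklore] -/
theorem filter_deg_eq_zero (hH : H ≤ zdGraph 2) {S : Finset (Site 2)} (v : Site 2) :
    (cfC[H, S, ∅]).filter (fun F => deg[F, v] = 0) = cfC[H, S.erase v, ∅] := by
  ext F
  rw [mem_filter, mem_cfConfigs_iff hH, mem_cfConfigs_iff hH]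
  constructor
  · rintro ⟨⟨hsub, -, hdeg⟩, h0⟩
    refine ⟨fun e he => mem_edgesIn_iff.2 ⟨(mem_edgesIn_iff.1 (hsub he)).1, fun z hz =>
      mem_erase.2 ⟨fun hzv => deg_eq_zero_iff.1 h0 e he (hzv ▸ hz), (mem_edgesIn_iff.1 (hsub he)).2 z hz⟩⟩,
      empty_subset _, fun z hz => ⟨fun h => absurd h (notMem_empty z), fun _ => ?_⟩⟩
    exact (hdeg z (mem_of_mem_erase hz)).2 (notMem_empty z)
  · rintro ⟨hsub, -, hdeg⟩
    have h0 : deg[F, v] = 0 := deg_eq_zero_iff.2 fun e he hve =>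
      (mem_erase.1 ((mem_edgesIn_iff.1 (hsub he)).2 v hve)).1 rfl
    refine ⟨⟨fun e he => mem_edgesIn_iff.2 ⟨(mem_edgesIn_iff.1 (hsub he)).1, fun z hz =>
      mem_of_mem_erase ((mem_edgesIn_iff.1 (hsub he)).2 z hz)⟩, empty_subset _, fun z hz =>
      ⟨fun h => absurd h (notMem_empty z), fun _ => ?_⟩⟩, h0⟩
    by_cases hzv : z = v
    · exact Or.inl (hzv ▸ h0)
    · exact (hdeg z (mem_erase.2 ⟨hzv, hz⟩)).2 (notMem_empty z)

/-- Removing an edge of a source-free collision-free configuration gives a two-source one. [folklore] -/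
theorem erase_mem_cfConfigs_empty (hH : H ≤ zdGraph 2) {S : Finset (Site 2)} {v u : Site 2}
    {F : Finset (Sym2 (Site 2))} (hF : F ∈ cfC[H, S, ∅]) (he : s(v, u) ∈ F) :
    F.erase s(v, u) ∈ cfC[H, S, {v} ∆ {u}] := by
  have hsub := subset_of_mem_cfConfigs hF
  have heH := mem_edgesIn_iff.1 (hsub he)
  have hvu : H.Adj v u := by simpa using heH.1
  refine erase_mem_cfConfigs hH hF he Subset.rfl (fun z hz => ?_) (fun e he' z hz => ?_)
    (fun z _ hz => ?_) (fun z _ hz => ?_)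
  · rw [mem_symmDiff, mem_singleton, mem_singleton] at hz
    rcases hz with ⟨rfl, -⟩ | ⟨rfl, -⟩
    exacts [heH.2 _ (Sym2.mem_mk_left _ _), heH.2 _ (Sym2.mem_mk_right _ _)]
  · exact (mem_edgesIn_iff.1 (hsub (mem_erase.1 he').2)).2 z hz
  · have hzv : z ≠ v := fun h => hz (h ▸ Sym2.mem_mk_left _ _)
    have hzu : z ≠ u := fun h => hz (h ▸ Sym2.mem_mk_right _ _)
    simp [mem_symmDiff, hzv, hzu]
  · rcases Sym2.mem_iff.1 hz with rfl | rfl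
    · simp [mem_symmDiff, hvu.ne]
    · simp [mem_symmDiff, Ne.symm hvu.ne]

/-- Closing the open strand `v → u` by the edge `{v, u}` gives a source-free configuration. [folklore] -/
theorem insert_mem_cfConfigs_empty (hH : H ≤ zdGraph 2) {S : Finset (Site 2)} {v u : Site 2}
    {F' : Finset (Sym2 (Site 2))} (hF' : F' ∈ cfC[H, S, {v} ∆ {u}]) (hvu : H.Adj v u)
    (he : s(v, u) ∉ F') : insert s(v, u) F' ∈ cfC[H, S, ∅] := by
  obtain ⟨-, hAS, -⟩ := (mem_cfConfigs_iff hH).1 hF'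
  have hv : v ∈ S := hAS (by simp [mem_symmDiff, hvu.ne])
  have hu : u ∈ S := hAS (by simp [mem_symmDiff, Ne.symm hvu.ne])
  refine insert_mem_cfConfigs hH hF' hvu hv hu he Subset.rfl (empty_subset _)
    (fun z hz hz' => absurd hz hz') (fun z _ hz => ?_) (fun z _ hz => ?_)
  · have hzv : z ≠ v := fun h => hz (h ▸ Sym2.mem_mk_left _ _)
    have hzu : z ≠ u := fun h => hz (h ▸ Sym2.mem_mk_right _ _)
    simp [mem_symmDiff, hzv, hzu]
  · rcases Sym2.mem_iff.1 hz with rfl | rfl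
    · simp [mem_symmDiff, hvu.ne]
    · simp [mem_symmDiff, Ne.symm hvu.ne]

/-- In a two-source configuration the only edge at the source `a` is the given one. [folklore] -/
theorem eq_of_mem_source (hH : H ≤ zdGraph 2) {S : Finset (Site 2)} {a b u : Site 2}
    {F : Finset (Sym2 (Site 2))} (hab : a ≠ b) (hF : F ∈ cfC[H, S, {a} ∆ {b}]) (hu : s(a, u) ∈ F)
    {e : Sym2 (Site 2)} (he : e ∈ F) (hae : a ∈ e) : e = s(a, u) := by
  obtain ⟨-, hAS, hdeg⟩ := (mem_cfConfigs_iff hH).1 hF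
  have haA : a ∈ ({a} ∆ {b} : Finset (Site 2)) := by simp [mem_symmDiff, hab]
  exact eq_of_deg_le_one ((hdeg a (hAS haA)).1 haA).le he hae hu (Sym2.mem_mk_left _ _)

/-- Endpoints of a configuration on `S' ⊆ S` lie in `S'` (volume comparison for `loops`). [folklore] -/
theorem vol_iff_of_mem_cfConfigs {S S' A' : Finset (Site 2)} {F' : Finset (Sym2 (Site 2))}
    (hF' : F' ∈ cfC[H, S', A']) (hS' : S' ⊆ S) :
    ∀ y : Site 2 × Dir, hedge y ∈ F' → (y.1 ∈ S ↔ y.1 ∈ S') := fun y hy =>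
  ⟨fun _ => (mem_edgesIn_iff.1 (subset_of_mem_cfConfigs hF' hy)).2 _ (fst_mem_hedge y), fun h => hS' h⟩

/-- Peeling the one-edge open strand `{a, b}` leaves a source-free configuration of `S ∖ {a, b}`.
[folklore] -/
theorem erase_mem_cfConfigs_end (hH : H ≤ zdGraph 2) {S : Finset (Site 2)} {a b : Site 2}
    {F : Finset (Sym2 (Site 2))} (hab : a ≠ b) (hF : F ∈ cfC[H, S, {a} ∆ {b}]) (he : s(a, b) ∈ F) :
    F.erase s(a, b) ∈ cfC[H, (S.erase a).erase b, ∅] := by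
  have hba : b ≠ a := hab.symm
  refine erase_mem_cfConfigs hH hF he ((erase_subset _ _).trans (erase_subset _ _)) (empty_subset _)
    (fun e' he' z hz => ?_) (fun z hz _ => ?_) (fun z hz hze => ?_)
  · obtain ⟨hne, he'⟩ := mem_erase.1 he'
    refine mem_erase.2 ⟨fun hzb => hne ?_, mem_erase.2 ⟨fun hza => hne ?_,
      (mem_edgesIn_iff.1 (subset_of_mem_cfConfigs hF he')).2 z hz⟩⟩
    · rw [symmDiff_comm] at hF
      rw [Sym2.eq_swap]
      exact eq_of_mem_source hH hba hF (by rw [Sym2.eq_swap]; exact he) he' (hzb ▸ hz)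
    · exact eq_of_mem_source hH hab hF he he' (hza ▸ hz)
  · have hzb : z ≠ b := (mem_erase.1 hz).1
    have hza : z ≠ a := (mem_erase.1 (mem_erase.1 hz).2).1
    simp [mem_symmDiff, hza, hzb]
  · exfalso
    rcases Sym2.mem_iff.1 hze with rfl | rfl
    · exact (mem_erase.1 (mem_erase.1 hz).2).1 rfl
    · exact (mem_erase.1 hz).1 rfl

/-- Adding the isolated edge `{a, b}` to a source-free configuration of `S ∖ {a, b}`. [folklore] -/
theorem insert_mem_cfConfigs_end (hH : H ≤ zdGraph 2) {S : Finset (Site 2)} {a b : Site 2}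
    {F' : Finset (Sym2 (Site 2))} (hab : a ≠ b) (hadj : H.Adj a b) (ha : a ∈ S) (hb : b ∈ S)
    (hF' : F' ∈ cfC[H, (S.erase a).erase b, ∅]) :
    insert s(a, b) F' ∈ cfC[H, S, {a} ∆ {b}] ∧ s(a, b) ∉ F' := by
  have hba : b ≠ a := hab.symm
  have he : s(a, b) ∉ F' := fun h => (mem_erase.1 (mem_erase.1 ((mem_edgesIn_iff.1
    (subset_of_mem_cfConfigs hF' h)).2 a (Sym2.mem_mk_left _ _))).2).1 rfl
  refine ⟨insert_mem_cfConfigs hH hF' hadj ha hb he ((erase_subset _ _).trans (erase_subset _ _))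
    (fun z hz => ?_) (fun z hz hz' => ?_) (fun z hz hze => ?_) (fun z hz hze => ?_), he⟩
  · rw [mem_symmDiff, mem_singleton, mem_singleton] at hz
    rcases hz with ⟨rfl, -⟩ | ⟨rfl, -⟩ <;> assumption
  · have : z = a ∨ z = b := by
      by_contra h
      rw [not_or] at h
      exact hz' (mem_erase.2 ⟨h.2, mem_erase.2 ⟨h.1, hz⟩⟩)
    rcases this with rfl | rfl
    · simp [mem_symmDiff, hab]
    · simp [mem_symmDiff, hba]
  · have hzb : z ≠ b := (mem_erase.1 hz).1
    have hza : z ≠ a := (mem_erase.1 (mem_erase.1 hz).2).1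
    simp [mem_symmDiff, hza, hzb]
  · exfalso
    rcases Sym2.mem_iff.1 hze with rfl | rfl
    · exact (mem_erase.1 (mem_erase.1 hz).2).1 rfl
    · exact (mem_erase.1 hz).1 rfl

/-- **Peeling the whole one-edge strand** `{a, b}`: `Σ_{F ∋ {a,b}} W(F) = x · Z(S ∖ {a, b}; ∅)`.
[folklore] -/
theorem sum_filter_source_edge_end (hH : H ≤ zdGraph 2) (x : ℝ) {S : Finset (Site 2)} {a b : Site 2}
    (hab : a ≠ b) (hadj : H.Adj a b) (ha : a ∈ S) (hb : b ∈ S) :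
    ∑ F ∈ (cfC[H, S, {a} ∆ {b}]).filter (fun F => s(a, b) ∈ F), lw[x, S, F] =
      x * pf[H, x, (S.erase a).erase b, ∅] := by
  rw [pfun_eq, mul_sum]
  refine sum_nbij' (fun F => F.erase s(a, b)) (fun F' => insert s(a, b) F')
    (fun F hF => erase_mem_cfConfigs_end hH hab (mem_filter.1 hF).1 (mem_filter.1 hF).2)
    (fun F' hF' => ?_) (fun F hF => insert_erase (mem_filter.1 hF).2)
    (fun F' hF' => erase_insert (insert_mem_cfConfigs_end hH hab hadj ha hb hF').2) (fun F hF => ?_)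
  · have h := insert_mem_cfConfigs_end hH hab hadj ha hb hF'
    exact mem_filter.2 ⟨h.1, mem_insert_self _ _⟩
  · obtain ⟨hF, he⟩ := mem_filter.1 hF
    rw [← card_erase_add_one he, pow_succ, loops_erase_source_edge hH hab hF he,
      loops_congr_vol (vol_iff_of_mem_cfConfigs (erase_mem_cfConfigs_end hH hab hF he)
        ((erase_subset _ _).trans (erase_subset _ _)))]
    ring

/-- Peeling the first edge `{a, u}` (`u ≠ b`) of the open strand leaves a configuration of `S ∖ a`
with sources `{u, b}`. [folklore] -/
theorem erase_mem_cfConfigs_start (hH : H ≤ zdGraph 2) {S : Finset (Site 2)} {a b u : Site 2}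
    {F : Finset (Sym2 (Site 2))} (hab : a ≠ b) (hub : u ≠ b) (hF : F ∈ cfC[H, S, {a} ∆ {b}])
    (he : s(a, u) ∈ F) : F.erase s(a, u) ∈ cfC[H, S.erase a, {u} ∆ {b}] := by
  have heH := mem_edgesIn_iff.1 (subset_of_mem_cfConfigs hF he)
  have hau : H.Adj a u := by simpa using heH.1
  obtain ⟨-, hAS, -⟩ := (mem_cfConfigs_iff hH).1 hF
  have hb : b ∈ S := hAS (by simp [mem_symmDiff, Ne.symm hab])
  refine erase_mem_cfConfigs hH hF he (erase_subset _ _) (fun z hz => ?_)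
    (fun e' he' z hz => ?_) (fun z hz hze => ?_) (fun z hz hze => ?_)
  · rw [mem_symmDiff, mem_singleton, mem_singleton] at hz
    rcases hz with ⟨rfl, -⟩ | ⟨rfl, -⟩
    · exact mem_erase.2 ⟨Ne.symm hau.ne, heH.2 _ (Sym2.mem_mk_right _ _)⟩
    · exact mem_erase.2 ⟨Ne.symm hab, hb⟩
  · obtain ⟨hne, he'⟩ := mem_erase.1 he'
    exact mem_erase.2 ⟨fun hza => hne (eq_of_mem_source hH hab hF he he' (hza ▸ hz)),
      (mem_edgesIn_iff.1 (subset_of_mem_cfConfigs hF he')).2 z hz⟩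
  · have hza : z ≠ a := (mem_erase.1 hz).1
    have hzu : z ≠ u := fun h => hze (h ▸ Sym2.mem_mk_right _ _)
    simp [mem_symmDiff, hza, hzu]
  · have hza : z ≠ a := (mem_erase.1 hz).1
    rcases Sym2.mem_iff.1 hze with rfl | rfl
    · exact absurd rfl hza
    · simp [mem_symmDiff, hub, Ne.symm hau.ne]

/-- Prepending the edge `{a, u}` to a configuration of `S ∖ a` with sources `{u, b}`. [folklore] -/
theorem insert_mem_cfConfigs_start (hH : H ≤ zdGraph 2) {S : Finset (Site 2)} {a b u : Site 2}
    {F' : Finset (Sym2 (Site 2))} (hab : a ≠ b) (hub : u ≠ b) (hau : H.Adj a u) (ha : a ∈ S)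
    (hF' : F' ∈ cfC[H, S.erase a, {u} ∆ {b}]) :
    insert s(a, u) F' ∈ cfC[H, S, {a} ∆ {b}] ∧ s(a, u) ∉ F' := by
  obtain ⟨-, hAS, -⟩ := (mem_cfConfigs_iff hH).1 hF'
  have hu : u ∈ S := mem_of_mem_erase (hAS (by simp [mem_symmDiff, hub]))
  have hb : b ∈ S := mem_of_mem_erase (hAS (by simp [mem_symmDiff, Ne.symm hub]))
  have he : s(a, u) ∉ F' := fun h =>
    (mem_erase.1 ((mem_edgesIn_iff.1 (subset_of_mem_cfConfigs hF' h)).2 a (Sym2.mem_mk_left _ _))).1 rfl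
  refine ⟨insert_mem_cfConfigs hH hF' hau ha hu he (erase_subset _ _) (fun z hz => ?_)
    (fun z hz hz' => ?_) (fun z hz hze => ?_) (fun z hz hze => ?_), he⟩
  · rw [mem_symmDiff, mem_singleton, mem_singleton] at hz
    rcases hz with ⟨rfl, -⟩ | ⟨rfl, -⟩ <;> assumption
  · have hza : z = a := by
      by_contra h
      exact hz' (mem_erase.2 ⟨h, hz⟩)
    subst hza
    simp [mem_symmDiff, hab]
  · have hza : z ≠ a := (mem_erase.1 hz).1
    have hzu : z ≠ u := fun h => hze (h ▸ Sym2.mem_mk_right _ _)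
    simp [mem_symmDiff, hza, hzu]
  · have hza : z ≠ a := (mem_erase.1 hz).1
    rcases Sym2.mem_iff.1 hze with rfl | rfl
    · exact absurd rfl hza
    · simp [mem_symmDiff, hub, Ne.symm hau.ne]

/-- **Peeling the first edge of the open strand**: for `u ≠ b`,
`Σ_{F ∋ {a,u}} W_S(F) = x · Z(S ∖ a; {u} ∆ {b})`. [folklore] -/
theorem sum_filter_source_edge_start (hH : H ≤ zdGraph 2) (x : ℝ) {S : Finset (Site 2)} {a b u : Site 2}
    (hab : a ≠ b) (hub : u ≠ b) (hau : H.Adj a u) (ha : a ∈ S) :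
    ∑ F ∈ (cfC[H, S, {a} ∆ {b}]).filter (fun F => s(a, u) ∈ F), lw[x, S, F] =
      x * pf[H, x, S.erase a, {u} ∆ {b}] := by
  rw [pfun_eq, mul_sum]
  refine sum_nbij' (fun F => F.erase s(a, u)) (fun F' => insert s(a, u) F')
    (fun F hF => erase_mem_cfConfigs_start hH hab hub (mem_filter.1 hF).1 (mem_filter.1 hF).2)
    (fun F' hF' => ?_) (fun F hF => insert_erase (mem_filter.1 hF).2)
    (fun F' hF' => erase_insert (insert_mem_cfConfigs_start hH hab hub hau ha hF').2) (fun F hF => ?_)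
  · have h := insert_mem_cfConfigs_start hH hab hub hau ha hF'
    exact mem_filter.2 ⟨h.1, mem_insert_self _ _⟩
  · obtain ⟨hF, he⟩ := mem_filter.1 hF
    rw [← card_erase_add_one he, pow_succ, loops_erase_source_edge hH hab hF he,
      loops_congr_vol (vol_iff_of_mem_cfConfigs (erase_mem_cfConfigs_start hH hab hub hF he)
        (erase_subset _ _))]
    ring

/-- **Opening a polygon at the edge `{v, u}`**:
`Σ_{F ∋ {v,u}, ∂F = ∅} W(F) = -2x · Σ_{F' ∌ {v,u}, ∂F' = {v,u}} W(F')`. [folklore] -/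
theorem sum_filter_cycle_edge (hH : H ≤ zdGraph 2) (x : ℝ) {S : Finset (Site 2)} {v u : Site 2}
    (hvu : H.Adj v u) :
    ∑ F ∈ (cfC[H, S, ∅]).filter (fun F => s(v, u) ∈ F), lw[x, S, F] =
      -2 * x * ∑ F' ∈ (cfC[H, S, {v} ∆ {u}]).filter (fun F' => s(v, u) ∉ F'), lw[x, S, F'] := by
  rw [mul_sum]
  refine sum_nbij' (fun F => F.erase s(v, u)) (fun F' => insert s(v, u) F') (fun F hF => ?_)
    (fun F' hF' => ?_) (fun F hF => insert_erase (mem_filter.1 hF).2)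
    (fun F' hF' => erase_insert (mem_filter.1 hF').2) (fun F hF => ?_)
  · exact mem_filter.2 ⟨erase_mem_cfConfigs_empty hH (mem_filter.1 hF).1 (mem_filter.1 hF).2,
      notMem_erase _ _⟩
  · exact mem_filter.2 ⟨insert_mem_cfConfigs_empty hH (mem_filter.1 hF').1 hvu (mem_filter.1 hF').2,
      mem_insert_self _ _⟩
  · obtain ⟨hF, he⟩ := mem_filter.1 hF
    rw [← card_erase_add_one he, pow_succ, loops_erase_cycle_edge hH hF he, pow_succ]
    ring

/-- **Vertex recursion of the source-free loop gas at `n = -2`**: for `v ∈ S`,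
`Z(S; ∅) = Z(S∖v; ∅) - x Σ_{u ∼ v} Z(S; {v} ∆ {u}) + x² Σ_{u ∼ v} Z(S∖{v,u}; ∅)`. [folklore] -/
theorem pfun_empty_eq (hH : H ≤ zdGraph 2) (x : ℝ) {S : Finset (Site 2)} {v : Site 2} (hv : v ∈ S) :
    pf[H, x, S, ∅] = pf[H, x, S.erase v, ∅] - x * ∑ u ∈ S, aind[H, v, u] * pf[H, x, S, {v} ∆ {u}] +
      x ^ 2 * ∑ u ∈ S, aind[H, v, u] * pf[H, x, (S.erase v).erase u, ∅] := by
  have hC : ∀ F ∈ cfC[H, S, ∅], F ⊆ edgesIn H S := fun F hF => subset_of_mem_cfConfigs hF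
  -- split off the configurations avoiding `v`
  have h1 : pf[H, x, S, ∅] = pf[H, x, S.erase v, ∅] +
      ∑ F ∈ (cfC[H, S, ∅]).filter (fun F => ¬deg[F, v] = 0), lw[x, S, F] := by
    rw [pfun_eq, pfun_eq, ← sum_filter_add_sum_filter_not _ (fun F => deg[F, v] = 0), filter_deg_eq_zero hH]
    congr 1
    refine sum_congr rfl fun F hF => ?_
    rw [loops_congr_vol (vol_iff_of_mem_cfConfigs hF (erase_subset _ _))]
  -- count the configurations through `v` twice, by the edges at `v`
  have h2 : 2 * ∑ F ∈ (cfC[H, S, ∅]).filter (fun F => ¬deg[F, v] = 0), lw[x, S, F] =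
      ∑ u ∈ S, ∑ F ∈ (cfC[H, S, ∅]).filter (fun F => s(v, u) ∈ F), lw[x, S, F] := by
    rw [sum_sum_filter_mk_mem hC, sum_filter, mul_sum]
    refine sum_congr rfl fun F hF => ?_
    rcases ((mem_cfConfigs_iff hH).1 hF).2.2 v hv |>.2 (notMem_empty v) with h | h
    · simp [h]
    · rw [if_pos (by rw [h]; decide), h]; norm_num
  -- open each polygon through `v` at one of its two edges at `v`
  have h3 : ∀ u ∈ S, ∑ F ∈ (cfC[H, S, ∅]).filter (fun F => s(v, u) ∈ F), lw[x, S, F] =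
      aind[H, v, u] * (-2 * x) * (pf[H, x, S, {v} ∆ {u}] - x * pf[H, x, (S.erase v).erase u, ∅]) := by
    intro u hu
    by_cases hvu : H.Adj v u
    · have hsplit := sum_filter_add_sum_filter_not (cfC[H, S, {v} ∆ {u}]) (fun F' => s(v, u) ∈ F')
        (fun F => lw[x, S, F])
      rw [sum_filter_source_edge_end hH x hvu.ne hvu hv hu] at hsplit
      rw [sum_filter_cycle_edge hH x hvu, aind_of_adj hvu, one_mul, pfun_eq (H := H) x S, ← hsplit]
      ring
    · rw [sum_filter_mk_mem_eq_zero hC hvu, aind_of_not_adj hvu]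
      ring
  have h4 : ∑ F ∈ (cfC[H, S, ∅]).filter (fun F => ¬deg[F, v] = 0), lw[x, S, F] =
      -x * ∑ u ∈ S, aind[H, v, u] * (pf[H, x, S, {v} ∆ {u}] - x * pf[H, x, (S.erase v).erase u, ∅]) := by
    have := h2
    rw [sum_congr rfl h3] at this
    rw [← mul_right_inj' (two_ne_zero (α := ℝ)), this, mul_sum, mul_sum]
    refine sum_congr rfl fun u _ => ?_
    ring
  rw [h1, h4, mul_sum, mul_sum, mul_sum]
  rw [sub_eq_add_neg, add_assoc, ← sum_neg_distrib, ← sum_add_distrib]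
  congr 1
  refine sum_congr rfl fun u _ => ?_
  ring

/-- **First-step recursion of the two-source loop gas at `n = -2`**: for `a ≠ b` in `S`,
`Z(S; {a} ∆ {b}) = x Σ_{u ∼ a, u ≠ b} Z(S∖a; {u} ∆ {b}) + x [a ∼ b] Z(S∖{a,b}; ∅)`. [folklore] -/
theorem pfun_two_eq (hH : H ≤ zdGraph 2) (x : ℝ) {S : Finset (Site 2)} {a b : Site 2} (ha : a ∈ S)
    (hab : a ≠ b) :
    pf[H, x, S, {a} ∆ {b}] = x * ∑ u ∈ S.erase a, aind[H, a, u] *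
      (if u = b then pf[H, x, (S.erase a).erase b, ∅] else pf[H, x, S.erase a, {u} ∆ {b}]) := by
  have hC : ∀ F ∈ cfC[H, S, {a} ∆ {b}], F ⊆ edgesIn H S := fun F hF => subset_of_mem_cfConfigs hF
  have haA : a ∈ ({a} ∆ {b} : Finset (Site 2)) := by simp [mem_symmDiff, hab]
  have h1 : pf[H, x, S, {a} ∆ {b}] =
      ∑ u ∈ S, ∑ F ∈ (cfC[H, S, {a} ∆ {b}]).filter (fun F => s(a, u) ∈ F), lw[x, S, F] := by
    rw [sum_sum_filter_mk_mem hC, pfun_eq]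
    refine sum_congr rfl fun F hF => ?_
    rw [(((mem_cfConfigs_iff hH).1 hF).2.2 a ha).1 haA]
    simp
  rw [h1, ← add_sum_erase _ _ ha, sum_filter_mk_mem_eq_zero hC (H.irrefl), zero_add, mul_sum]
  refine sum_congr rfl fun u hu => ?_
  by_cases hau : H.Adj a u
  · rw [aind_of_adj hau]
    by_cases hub : u = b
    · subst hub
      rw [if_pos rfl, sum_filter_source_edge_end hH x hab hau ha (mem_of_mem_erase hu)]
      ring
    · rw [if_neg hub, sum_filter_source_edge_start hH x hab hub hau ha]
      ring
  · rw [sum_filter_mk_mem_eq_zero hC hau, aind_of_not_adj hau]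
    ring

end LoopGas

end DetExpansion

/-- Registered sub-goal of this helper file (stub `stub_determinantal`, file 5/5): **the strictly
dilute loop gas at `n = -2` is the sum of `x^{|F|}(-2)^{loops}` over collision-free configurations**.
[folklore] -/
theorem partitionFunction_negTwo_eq_sum :
    ∀ (H : SimpleGraph (Site 2)) [H.LocallyFinite] (x : ℝ) (S A : Finset (Site 2)),
      (⟨-2, 0, x⟩ : DiluteLoopModel ℝ).partitionFunction H S A =
        ∑ F ∈ (DiluteLoopModel.configs H S A).filter (fun F => DiluteLoopModel.oscVerts S F = ∅),
          x ^ #F * (-2 : ℝ) ^ DiluteLoopModel.loops S F ∅ :=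
  fun _ _ x S A => DetExpansion.pfun_eq x S A

end Summit.CriticalPhenomena.SAWScalingLimit.Theorems.AvoidanceLimit.Anchor

end
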